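import Summits.ValiantsHypothesis.ValiantsHypothesis.Theorems.KPlusLogSqLawValuativeDoorDominantChain

/-!
# LINE `valuative_door` (crux `WeakLifting`, stmt-ValiantsHypothesis-19561) — DOMINANT EXPONENT CLASSES of an exchange system with
# REPEATED slopes: at most `m (K − 1) + 1` classes are ever on top (the cancellation-free count)

HONEST FRAMING.  Helper (cell `pub-symmetroid`, seat val-sym-lift-p1 g22, 2026-08-29; `--supports 19561 --as helper`).  The landed
`…ValuativeDoorDominantChain` counts uniquely-top SETS and needs DISTINCT slopes `d`.  A general symmetric lacunary pencil is a rank-one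
pencil with REPEATED letter exponents (`…ValuativeDoorRankOneLawToMDR`), so the honest abstract object is an exchange system (family `𝒮` of
`m`-sets, log-weights `a`, Dress–Wenzel exchange axiom) with ARBITRARY slopes `d : Fin K → ℕ`, and the honest count is of EXPONENT CLASSES
`E` that are on top at some slope `t` in the sense: some `S ∈ 𝒮` with `E(S) = E` satisfies `ℓ_T(t) ≤ ℓ_S(t)` for all `T ∈ 𝒮`, strictly when
`E(T) ≠ E` (`ℓ_S(t) = a(S) + t·E(S)`).  THEOREM (`card_dominantClasses_le`): at most `m (K − 1) + 1` classes are ever on top.  Tools: Gale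
domination of the top tie (landed `filter_card_le_of_tieMax`, which never used distinct slopes), the exponent as a sum of threshold
counts (`sum_eq_sum_range_filter_card`), hence STRICT growth of the rank potential from any tie of smaller exponent to the top tie
(`rankPotential_lt_of_tieMax_of_sum_lt`) and EQUAL rank potential for two top ties (`rankPotential_eq_of_tieMax_both`); the breakpoint
chain (`exists_next_dominantClass`, `rankPotential_lt_of_dominantClass`) as in the landed file, with classes in place of sets.  This is the
VIRTUAL (cancellation-free) count: for an actual pencil the coefficient of `X^E` is the class SUM of the virtual coefficients and may
cancel — that cancellation is exactly what separates this polynomial count from the line's open statements (`…ValuativeDoorCancellationFree`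
draws the consequences).  Pure combinatorics; closes nothing; no bearing on vW / vB, `TropicalB`, `MatrixDescartes` (18050) or VP ≠ VNP.
-/

set_option linter.dupNamespace false
set_option autoImplicit false

namespace Summit.ValiantsHypothesis.ValiantsHypothesis.Theorems.KPlusLogSqLaw.ValDoor

open Finset
open scoped BigOperators Classical

variable {K : ℕ}

/-! ## §1 Exponents as sums of threshold counts -/

/-- `E(S) = Σ_{j < D} #{l ∈ S : j < d l}` when `D` bounds the slopes. [bookkeeping: double counting] -/
theorem sum_eq_sum_range_filter_card (d : Fin K → ℕ) (S : Finset (Fin K)) (D : ℕ) (hD : ∀ l, d l ≤ D) :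
    ∑ l ∈ S, d l = ∑ j ∈ Finset.range D, (S.filter fun l => j < d l).card := by
  have h1 : ∀ l, d l = ∑ j ∈ Finset.range D, if j < d l then 1 else 0 := by
    intro l
    rw [Finset.sum_ite, Finset.sum_const_zero, add_zero, Finset.sum_const, smul_eq_mul, mul_one]
    have : (Finset.range D).filter (fun j => j < d l) = Finset.range (d l) := by
      ext j
      simp only [Finset.mem_filter, Finset.mem_range]
      exact ⟨fun h => h.2, fun h => ⟨lt_of_lt_of_le h (hD l), h⟩⟩
    rw [this, Finset.card_range]
  simp only [Finset.card_filter]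
  rw [Finset.sum_comm]
  exact Finset.sum_congr rfl fun l _ => h1 l

/-- every integer threshold count is a letter threshold count (or the full count). [bookkeeping] -/
theorem filter_card_threshold (d : Fin K → ℕ) (S : Finset (Fin K)) (j : ℕ) :
    (∃ x : Fin K, d x ≤ j ∧ (S.filter fun l => j < d l) = S.filter fun l => d x < d l) ∨
      (S.filter fun l => j < d l) = S := by
  by_cases h : ∃ x : Fin K, d x ≤ j
  · left
    obtain ⟨x₀, hx₀, hmax⟩ := Finset.exists_max_image (univ.filter fun x : Fin K => d x ≤ j) d
      (by obtain ⟨x, hx⟩ := h; exact ⟨x, Finset.mem_filter.2 ⟨Finset.mem_univ _, hx⟩⟩)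
    have hx₀j : d x₀ ≤ j := (Finset.mem_filter.1 hx₀).2
    refine ⟨x₀, hx₀j, ?_⟩
    ext l
    simp only [Finset.mem_filter]
    refine ⟨fun ⟨hl, hjl⟩ => ⟨hl, lt_of_le_of_lt hx₀j hjl⟩, fun ⟨hl, hxl⟩ => ⟨hl, not_le.1 fun hle => ?_⟩⟩
    exact absurd hxl (not_lt.2 (hmax l (Finset.mem_filter.2 ⟨Finset.mem_univ _, hle⟩)))
  · right
    push Not at h
    ext l
    simp only [Finset.mem_filter, and_iff_left_iff_imp]
    exact fun _ => h l

/-! ## §2 Rank potential across a tie family, repeated slopes -/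

/-- **weak growth:** the top tie has rank potential at least that of every tie (no distinct-slope hypothesis). [from `filter_card_le_of_tieMax`] -/
theorem rankPotential_le_of_tieMax (𝒮 : Finset (Finset (Fin K))) (a : Finset (Fin K) → ℝ) (d : Fin K → ℕ)
    (m : ℕ) (hcard : ∀ S ∈ 𝒮, S.card = m)
    (hX : ∀ A ∈ 𝒮, ∀ B ∈ 𝒮, ∀ i ∈ A \ B, ∃ j ∈ B \ A, insert j (A.erase i) ∈ 𝒮 ∧ insert i (B.erase j) ∈ 𝒮 ∧
      a A + a B ≤ a (insert j (A.erase i)) + a (insert i (B.erase j)))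
    (s M : ℝ) (hmax : ∀ T ∈ 𝒮, a T + s * ((∑ l ∈ T, d l : ℕ) : ℝ) ≤ M)
    {J : Finset (Fin K)} (hJ : J ∈ 𝒮) (hJM : a J + s * ((∑ l ∈ J, d l : ℕ) : ℝ) = M)
    (hJtop : ∀ T ∈ 𝒮, a T + s * ((∑ l ∈ T, d l : ℕ) : ℝ) = M → ∑ l ∈ T, d l ≤ ∑ l ∈ J, d l)
    {I : Finset (Fin K)} (hI : I ∈ 𝒮) (hIM : a I + s * ((∑ l ∈ I, d l : ℕ) : ℝ) = M) :
    ∑ l ∈ I, (univ.filter fun x => d x < d l).card ≤ ∑ l ∈ J, (univ.filter fun x => d x < d l).card := by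
  have hdom : ∀ θ : ℕ, (I.filter fun l => θ < d l).card ≤ (J.filter fun l => θ < d l).card :=
    filter_card_le_of_tieMax 𝒮 a d m hcard hX s M hmax hJ hJM hJtop _ I hI hIM rfl
  rw [rankPotential_eq_sum_filter_card d I, rankPotential_eq_sum_filter_card d J]
  exact Finset.sum_le_sum fun x _ => hdom (d x)

/-- **strict growth from a tie of smaller exponent** (no distinct-slope hypothesis): if a tie `I` has `E(I) < E(J)` for the top tie `J`
then `Φ(I) < Φ(J)` — equal rank potentials would force equal threshold counts at every letter slope, hence at every integer threshold,
hence `E(I) = E(J)`. [elementary] -/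
theorem rankPotential_lt_of_tieMax_of_sum_lt (𝒮 : Finset (Finset (Fin K))) (a : Finset (Fin K) → ℝ) (d : Fin K → ℕ)
    (m : ℕ) (hcard : ∀ S ∈ 𝒮, S.card = m)
    (hX : ∀ A ∈ 𝒮, ∀ B ∈ 𝒮, ∀ i ∈ A \ B, ∃ j ∈ B \ A, insert j (A.erase i) ∈ 𝒮 ∧ insert i (B.erase j) ∈ 𝒮 ∧
      a A + a B ≤ a (insert j (A.erase i)) + a (insert i (B.erase j)))
    (s M : ℝ) (hmax : ∀ T ∈ 𝒮, a T + s * ((∑ l ∈ T, d l : ℕ) : ℝ) ≤ M)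
    {J : Finset (Fin K)} (hJ : J ∈ 𝒮) (hJM : a J + s * ((∑ l ∈ J, d l : ℕ) : ℝ) = M)
    (hJtop : ∀ T ∈ 𝒮, a T + s * ((∑ l ∈ T, d l : ℕ) : ℝ) = M → ∑ l ∈ T, d l ≤ ∑ l ∈ J, d l)
    {I : Finset (Fin K)} (hI : I ∈ 𝒮) (hIM : a I + s * ((∑ l ∈ I, d l : ℕ) : ℝ) = M)
    (hlt : ∑ l ∈ I, d l < ∑ l ∈ J, d l) :
    ∑ l ∈ I, (univ.filter fun x => d x < d l).card < ∑ l ∈ J, (univ.filter fun x => d x < d l).card := by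
  have hdom : ∀ θ : ℕ, (I.filter fun l => θ < d l).card ≤ (J.filter fun l => θ < d l).card :=
    filter_card_le_of_tieMax 𝒮 a d m hcard hX s M hmax hJ hJM hJtop _ I hI hIM rfl
  have hle := rankPotential_le_of_tieMax 𝒮 a d m hcard hX s M hmax hJ hJM hJtop hI hIM
  refine lt_of_le_of_ne hle fun heq => ?_
  -- equal potentials: all letter-threshold counts agree
  rw [rankPotential_eq_sum_filter_card d I, rankPotential_eq_sum_filter_card d J] at heq
  have hx : ∀ x : Fin K, (I.filter fun l => d x < d l).card = (J.filter fun l => d x < d l).card :=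
    fun x => (Finset.sum_eq_sum_iff_of_le fun y _ => hdom (d y)).1 heq x (Finset.mem_univ x)
  -- hence all integer-threshold counts agree
  have hj : ∀ j : ℕ, (I.filter fun l => j < d l).card = (J.filter fun l => j < d l).card := by
    intro j
    rcases filter_card_threshold d I j with ⟨x, hxj, hIx⟩ | hIall
    · rcases filter_card_threshold d J j with ⟨y, hyj, hJy⟩ | hJall
      · -- both are letter thresholds; compare through the larger letter
        have key : ∀ (S : Finset (Fin K)) (z : Fin K), d z ≤ j →
            (S.filter fun l => j < d l) ⊆ S.filter fun l => d z < d l := by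
          intro S z hz l hl
          obtain ⟨hlS, hjl⟩ := Finset.mem_filter.1 hl
          exact Finset.mem_filter.2 ⟨hlS, lt_of_le_of_lt hz hjl⟩
        apply le_antisymm
        · calc (I.filter fun l => j < d l).card ≤ (I.filter fun l => d y < d l).card := Finset.card_le_card (key I y hyj)
            _ = (J.filter fun l => d y < d l).card := hx y
            _ = (J.filter fun l => j < d l).card := by rw [hJy]
        · calc (J.filter fun l => j < d l).card ≤ (J.filter fun l => d x < d l).card := Finset.card_le_card (key J x hxj)
            _ = (I.filter fun l => d x < d l).card := (hx x).symm
            _ = (I.filter fun l => j < d l).card := by rw [hIx]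
      · -- J has no letter below j+1... then neither count can differ: J's count is m ≥ I's, and I's equals J's at d x
        rw [hJall, hIx, hx x]
        apply le_antisymm (Finset.card_le_card (Finset.filter_subset _ _))
        calc J.card = (J.filter fun l => j < d l).card := by rw [hJall]
          _ ≤ (J.filter fun l => d x < d l).card := Finset.card_le_card (fun l hl => by
              obtain ⟨hlJ, hjl⟩ := Finset.mem_filter.1 hl
              exact Finset.mem_filter.2 ⟨hlJ, lt_of_le_of_lt hxj hjl⟩)
    · rcases filter_card_threshold d J j with ⟨y, hyj, hJy⟩ | hJall
      · rw [hIall, hJy, ← hx y]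
        apply le_antisymm ?_ (Finset.card_le_card (Finset.filter_subset _ _))
        calc I.card = (I.filter fun l => j < d l).card := by rw [hIall]
          _ ≤ (I.filter fun l => d y < d l).card := Finset.card_le_card (fun l hl => by
              obtain ⟨hlI, hjl⟩ := Finset.mem_filter.1 hl
              exact Finset.mem_filter.2 ⟨hlI, lt_of_le_of_lt hyj hjl⟩)
      · rw [hIall, hJall, hcard I hI, hcard J hJ]
  -- hence equal exponents, contradiction
  set D : ℕ := univ.sup d + 1 with hD
  have hDb : ∀ l : Fin K, d l ≤ D := fun l => (Finset.le_sup (Finset.mem_univ l)).trans (Nat.le_succ _)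
  have hE : ∑ l ∈ I, d l = ∑ l ∈ J, d l := by
    rw [sum_eq_sum_range_filter_card d I D hDb, sum_eq_sum_range_filter_card d J D hDb]
    exact Finset.sum_congr rfl fun j _ => hj j
  rw [hE] at hlt
  exact lt_irrefl _ hlt

/-- **two top ties have the same rank potential** (Gale domination both ways). [elementary] -/
theorem rankPotential_eq_of_tieMax_both (𝒮 : Finset (Finset (Fin K))) (a : Finset (Fin K) → ℝ) (d : Fin K → ℕ)
    (m : ℕ) (hcard : ∀ S ∈ 𝒮, S.card = m)
    (hX : ∀ A ∈ 𝒮, ∀ B ∈ 𝒮, ∀ i ∈ A \ B, ∃ j ∈ B \ A, insert j (A.erase i) ∈ 𝒮 ∧ insert i (B.erase j) ∈ 𝒮 ∧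
      a A + a B ≤ a (insert j (A.erase i)) + a (insert i (B.erase j)))
    (s M : ℝ) (hmax : ∀ T ∈ 𝒮, a T + s * ((∑ l ∈ T, d l : ℕ) : ℝ) ≤ M)
    {J J' : Finset (Fin K)} (hJ : J ∈ 𝒮) (hJM : a J + s * ((∑ l ∈ J, d l : ℕ) : ℝ) = M)
    (hJtop : ∀ T ∈ 𝒮, a T + s * ((∑ l ∈ T, d l : ℕ) : ℝ) = M → ∑ l ∈ T, d l ≤ ∑ l ∈ J, d l)
    (hJ' : J' ∈ 𝒮) (hJ'M : a J' + s * ((∑ l ∈ J', d l : ℕ) : ℝ) = M)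
    (hJ'top : ∀ T ∈ 𝒮, a T + s * ((∑ l ∈ T, d l : ℕ) : ℝ) = M → ∑ l ∈ T, d l ≤ ∑ l ∈ J', d l) :
    ∑ l ∈ J, (univ.filter fun x => d x < d l).card = ∑ l ∈ J', (univ.filter fun x => d x < d l).card :=
  le_antisymm (rankPotential_le_of_tieMax 𝒮 a d m hcard hX s M hmax hJ' hJ'M hJ'top hJ hJM)
    (rankPotential_le_of_tieMax 𝒮 a d m hcard hX s M hmax hJ hJM hJtop hJ' hJ'M)

/-! ## §3 The chain of dominant classes -/

/-- **THE BREAKPOINT STEP FOR CLASSES.**  `S` on top at `s` (weakly over its own class, strictly over the other classes), `S'` on top at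
`s' > s` with `E(S') ≠ E(S)`: there is `J₁ ∈ 𝒮` with `E(S) < E(J₁)` and `Φ(S) < Φ(J₁)`, and either `J₁` is in the class of `S'` with the same
rank potential as `S'`, or `J₁` is on top at some `t₁ < s'` with `E(J₁) ≠ E(S')`. [elementary; no distinct-slope hypothesis] -/
theorem exists_next_dominantClass (𝒮 : Finset (Finset (Fin K))) (a : Finset (Fin K) → ℝ) (d : Fin K → ℕ)
    (m : ℕ) (hcard : ∀ S ∈ 𝒮, S.card = m)
    (hX : ∀ A ∈ 𝒮, ∀ B ∈ 𝒮, ∀ i ∈ A \ B, ∃ j ∈ B \ A, insert j (A.erase i) ∈ 𝒮 ∧ insert i (B.erase j) ∈ 𝒮 ∧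
      a A + a B ≤ a (insert j (A.erase i)) + a (insert i (B.erase j)))
    {S S' : Finset (Fin K)} {s s' : ℝ} (hS : S ∈ 𝒮)
    (hSle : ∀ T ∈ 𝒮, a T + s * ((∑ l ∈ T, d l : ℕ) : ℝ) ≤ a S + s * ((∑ l ∈ S, d l : ℕ) : ℝ))
    (hSlt : ∀ T ∈ 𝒮, ∑ l ∈ T, d l ≠ ∑ l ∈ S, d l → a T + s * ((∑ l ∈ T, d l : ℕ) : ℝ) < a S + s * ((∑ l ∈ S, d l : ℕ) : ℝ))
    (hS' : S' ∈ 𝒮)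
    (hS'le : ∀ T ∈ 𝒮, a T + s' * ((∑ l ∈ T, d l : ℕ) : ℝ) ≤ a S' + s' * ((∑ l ∈ S', d l : ℕ) : ℝ))
    (hS'lt : ∀ T ∈ 𝒮, ∑ l ∈ T, d l ≠ ∑ l ∈ S', d l →
      a T + s' * ((∑ l ∈ T, d l : ℕ) : ℝ) < a S' + s' * ((∑ l ∈ S', d l : ℕ) : ℝ))
    (hss : s < s') (hne : ∑ l ∈ S, d l ≠ ∑ l ∈ S', d l) :
    ∃ J₁ ∈ 𝒮, ∑ l ∈ S, d l < ∑ l ∈ J₁, d l ∧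
      ∑ l ∈ S, (univ.filter fun x => d x < d l).card < ∑ l ∈ J₁, (univ.filter fun x => d x < d l).card ∧
      ((∑ l ∈ J₁, d l = ∑ l ∈ S', d l ∧
          ∑ l ∈ J₁, (univ.filter fun x => d x < d l).card = ∑ l ∈ S', (univ.filter fun x => d x < d l).card) ∨
        ∃ t₁ : ℝ, t₁ < s' ∧ ∑ l ∈ J₁, d l ≠ ∑ l ∈ S', d l ∧
          (∀ T ∈ 𝒮, a T + t₁ * ((∑ l ∈ T, d l : ℕ) : ℝ) ≤ a J₁ + t₁ * ((∑ l ∈ J₁, d l : ℕ) : ℝ)) ∧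
          (∀ T ∈ 𝒮, ∑ l ∈ T, d l ≠ ∑ l ∈ J₁, d l →
            a T + t₁ * ((∑ l ∈ T, d l : ℕ) : ℝ) < a J₁ + t₁ * ((∑ l ∈ J₁, d l : ℕ) : ℝ))) := by
  -- (1) E S < E S'
  have hESS' : ∑ l ∈ S, d l < ∑ l ∈ S', d l := by
    have h : ((∑ l ∈ S, d l : ℕ) : ℝ) < ((∑ l ∈ S', d l : ℕ) : ℝ) :=
      slope_lt_of_swap (hSlt S' hS' (Ne.symm hne)) (hS'lt S hS hne) hss
    exact_mod_cast h
  -- (2) the larger-exponent sets and the first catch s*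
  set 𝒯 : Finset (Finset (Fin K)) := 𝒮.filter fun T => ∑ l ∈ S, d l < ∑ l ∈ T, d l with h𝒯
  set c : Finset (Fin K) → ℝ := fun T => (a S - a T) / (((∑ l ∈ T, d l : ℕ) : ℝ) - ((∑ l ∈ S, d l : ℕ) : ℝ)) with hc
  have hS'𝒯 : S' ∈ 𝒯 := Finset.mem_filter.2 ⟨hS', hESS'⟩
  have h𝒯ne : (𝒯.image c).Nonempty := ⟨c S', Finset.mem_image_of_mem c hS'𝒯⟩
  set sstar : ℝ := (𝒯.image c).min' h𝒯ne with hsstar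
  have hsstar_le : ∀ T ∈ 𝒯, sstar ≤ c T := fun T hT => Finset.min'_le _ _ (Finset.mem_image_of_mem c hT)
  obtain ⟨T₀, hT₀𝒯, hT₀c⟩ : ∃ T₀ ∈ 𝒯, c T₀ = sstar := Finset.mem_image.1 (Finset.min'_mem _ h𝒯ne)
  obtain ⟨hT₀, hT₀E⟩ := Finset.mem_filter.1 hT₀𝒯
  have hT₀E' : ((∑ l ∈ S, d l : ℕ) : ℝ) < ((∑ l ∈ T₀, d l : ℕ) : ℝ) := by exact_mod_cast hT₀E
  have hs_lt : s < sstar := by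
    rw [← hT₀c]
    exact (line_lt_iff_lt_cross hT₀E' s).1 (hSlt T₀ hT₀ (ne_of_gt hT₀E))
  have hESS'r : ((∑ l ∈ S, d l : ℕ) : ℝ) < ((∑ l ∈ S', d l : ℕ) : ℝ) := by exact_mod_cast hESS'
  have hcS' : c S' < s' := by
    by_contra h
    rw [not_lt] at h
    exact absurd (hS'lt S hS hne) (not_lt.2 ((line_le_iff_le_cross hESS'r s').2 h))
  have hsstar_lt : sstar < s' := (hsstar_le S' hS'𝒯).trans_lt hcS'
  -- (3) at s* the line of S is on top
  set M : ℝ := a S + sstar * ((∑ l ∈ S, d l : ℕ) : ℝ) with hM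
  have hmax : ∀ T ∈ 𝒮, a T + sstar * ((∑ l ∈ T, d l : ℕ) : ℝ) ≤ M := by
    intro T hT
    rcases lt_trichotomy (∑ l ∈ T, d l) (∑ l ∈ S, d l) with hlt | heq | hgt
    · have hlt' : ((∑ l ∈ T, d l : ℕ) : ℝ) < ((∑ l ∈ S, d l : ℕ) : ℝ) := by exact_mod_cast hlt
      exact (line_lt_of_le_of_lt (hSlt T hT (ne_of_lt hlt)).le hlt' hs_lt).le
    · have h1 := hSle T hT
      rw [heq] at h1 ⊢
      linarith
    · have hgt' : ((∑ l ∈ S, d l : ℕ) : ℝ) < ((∑ l ∈ T, d l : ℕ) : ℝ) := by exact_mod_cast hgt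
      exact (line_le_iff_le_cross hgt' sstar).2 (hsstar_le T (Finset.mem_filter.2 ⟨hT, hgt⟩))
  have hSM : a S + sstar * ((∑ l ∈ S, d l : ℕ) : ℝ) = M := rfl
  have hT₀M : a T₀ + sstar * ((∑ l ∈ T₀, d l : ℕ) : ℝ) = M := by
    refine le_antisymm (hmax T₀ hT₀) (not_lt.1 fun hlt => ?_)
    have hlt' : sstar < c T₀ := (line_lt_iff_lt_cross hT₀E' sstar).1 hlt
    rw [hT₀c] at hlt'
    exact lt_irrefl _ hlt'
  -- (4) the top tie J₁
  set Tie : Finset (Finset (Fin K)) := 𝒮.filter fun T => a T + sstar * ((∑ l ∈ T, d l : ℕ) : ℝ) = M with hTie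
  obtain ⟨J₁, hJ₁Tie, hJ₁max⟩ := Finset.exists_max_image Tie (fun T => ∑ l ∈ T, d l) ⟨S, Finset.mem_filter.2 ⟨hS, hSM⟩⟩
  obtain ⟨hJ₁, hJ₁M⟩ := Finset.mem_filter.1 hJ₁Tie
  have hJtop : ∀ T ∈ 𝒮, a T + sstar * ((∑ l ∈ T, d l : ℕ) : ℝ) = M → ∑ l ∈ T, d l ≤ ∑ l ∈ J₁, d l :=
    fun T hT hTM => hJ₁max T (Finset.mem_filter.2 ⟨hT, hTM⟩)
  have hESJ₁ : ∑ l ∈ S, d l < ∑ l ∈ J₁, d l := hT₀E.trans_le (hJtop T₀ hT₀ hT₀M)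
  have hΦ := rankPotential_lt_of_tieMax_of_sum_lt 𝒮 a d m hcard hX sstar M hmax hJ₁ hJ₁M hJtop hS hSM hESJ₁
  refine ⟨J₁, hJ₁, hESJ₁, hΦ, ?_⟩
  by_cases hE1 : ∑ l ∈ J₁, d l = ∑ l ∈ S', d l
  · -- (5a) J₁ is in the class of S': both are top ties at s', equal rank potential
    left
    refine ⟨hE1, ?_⟩
    have hE1r : ((∑ l ∈ J₁, d l : ℕ) : ℝ) = ((∑ l ∈ S', d l : ℕ) : ℝ) := by exact_mod_cast hE1
    have haJS : a J₁ = a S' := by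
      apply le_antisymm
      · have h1 := hS'le J₁ hJ₁
        rw [hE1r] at h1
        linarith
      · have h1 := hmax S' hS'
        rw [← hJ₁M, ← hE1r] at h1
        linarith
    have hJ₁M' : a J₁ + s' * ((∑ l ∈ J₁, d l : ℕ) : ℝ) = a S' + s' * ((∑ l ∈ S', d l : ℕ) : ℝ) := by rw [haJS, hE1r]
    have htop' : ∀ T ∈ 𝒮, a T + s' * ((∑ l ∈ T, d l : ℕ) : ℝ) = a S' + s' * ((∑ l ∈ S', d l : ℕ) : ℝ) →
        ∑ l ∈ T, d l ≤ ∑ l ∈ S', d l := by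
      intro T hT hTM
      refine le_of_eq (not_ne_iff.1 fun hneT => ?_)
      exact absurd hTM (ne_of_lt (hS'lt T hT hneT))
    have htop'' : ∀ T ∈ 𝒮, a T + s' * ((∑ l ∈ T, d l : ℕ) : ℝ) = a S' + s' * ((∑ l ∈ S', d l : ℕ) : ℝ) →
        ∑ l ∈ T, d l ≤ ∑ l ∈ J₁, d l := fun T hT hTM => hE1 ▸ htop' T hT hTM
    exact (rankPotential_eq_of_tieMax_both 𝒮 a d m hcard hX s' _ hS'le hS' rfl htop' hJ₁ hJ₁M' htop'').symm
  · -- (5b) J₁ is on top just after s*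
    right
    have hEJ₁S' : ∑ l ∈ J₁, d l < ∑ l ∈ S', d l := by
      refine lt_of_le_of_ne (not_lt.1 fun hgt => ?_) hE1
      have hgt' : ((∑ l ∈ S', d l : ℕ) : ℝ) < ((∑ l ∈ J₁, d l : ℕ) : ℝ) := by exact_mod_cast hgt
      have h1 : a S' + sstar * ((∑ l ∈ S', d l : ℕ) : ℝ) ≤ a J₁ + sstar * ((∑ l ∈ J₁, d l : ℕ) : ℝ) := by
        rw [hJ₁M]; exact hmax S' hS'
      exact absurd (hS'le J₁ hJ₁) (not_le.2 (line_lt_of_le_of_lt h1 hgt' hsstar_lt))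
    set 𝒰 : Finset (Finset (Fin K)) := 𝒮.filter fun T => ∑ l ∈ J₁, d l < ∑ l ∈ T, d l with h𝒰
    set c₁ : Finset (Fin K) → ℝ := fun T => (a J₁ - a T) / (((∑ l ∈ T, d l : ℕ) : ℝ) - ((∑ l ∈ J₁, d l : ℕ) : ℝ)) with hc₁
    have hS'𝒰 : S' ∈ 𝒰 := Finset.mem_filter.2 ⟨hS', hEJ₁S'⟩
    have h𝒰ne : (𝒰.image c₁).Nonempty := ⟨c₁ S', Finset.mem_image_of_mem c₁ hS'𝒰⟩
    set tplus : ℝ := (𝒰.image c₁).min' h𝒰ne with htplus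
    have htplus_le : ∀ T ∈ 𝒰, tplus ≤ c₁ T := fun T hT => Finset.min'_le _ _ (Finset.mem_image_of_mem c₁ hT)
    obtain ⟨T₁, hT₁𝒰, hT₁c⟩ : ∃ T₁ ∈ 𝒰, c₁ T₁ = tplus := Finset.mem_image.1 (Finset.min'_mem _ h𝒰ne)
    obtain ⟨hT₁, hT₁E⟩ := Finset.mem_filter.1 hT₁𝒰
    have hT₁E' : ((∑ l ∈ J₁, d l : ℕ) : ℝ) < ((∑ l ∈ T₁, d l : ℕ) : ℝ) := by exact_mod_cast hT₁E
    have hsstar_tplus : sstar < tplus := by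
      rw [← hT₁c]
      refine (line_lt_iff_lt_cross hT₁E' sstar).1 (lt_of_le_of_ne (hJ₁M.symm ▸ hmax T₁ hT₁) fun hT₁M => ?_)
      have := hJtop T₁ hT₁ (hT₁M.trans hJ₁M)
      exact absurd hT₁E (not_lt.2 this)
    have hEJ₁S'r : ((∑ l ∈ J₁, d l : ℕ) : ℝ) < ((∑ l ∈ S', d l : ℕ) : ℝ) := by exact_mod_cast hEJ₁S'
    have hc₁S' : c₁ S' < s' := by
      by_contra h
      rw [not_lt] at h
      exact absurd (hS'lt J₁ hJ₁ hE1) (not_lt.2 ((line_le_iff_le_cross hEJ₁S'r s').2 h))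
    have htplus_lt : tplus < s' := (htplus_le S' hS'𝒰).trans_lt hc₁S'
    have hkey : ∀ T ∈ 𝒮, (∑ l ∈ T, d l ≠ ∑ l ∈ J₁, d l →
        a T + (sstar + tplus) / 2 * ((∑ l ∈ T, d l : ℕ) : ℝ) < a J₁ + (sstar + tplus) / 2 * ((∑ l ∈ J₁, d l : ℕ) : ℝ)) ∧
        (∑ l ∈ T, d l = ∑ l ∈ J₁, d l →
        a T + (sstar + tplus) / 2 * ((∑ l ∈ T, d l : ℕ) : ℝ) ≤ a J₁ + (sstar + tplus) / 2 * ((∑ l ∈ J₁, d l : ℕ) : ℝ)) := by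
      intro T hT
      refine ⟨fun hTne => ?_, fun hTeq => ?_⟩
      · rcases lt_or_gt_of_ne hTne with hlt | hgt
        · have hlt' : ((∑ l ∈ T, d l : ℕ) : ℝ) < ((∑ l ∈ J₁, d l : ℕ) : ℝ) := by exact_mod_cast hlt
          exact line_lt_of_le_of_lt (hJ₁M.symm ▸ hmax T hT) hlt' (by linarith)
        · have hgt' : ((∑ l ∈ J₁, d l : ℕ) : ℝ) < ((∑ l ∈ T, d l : ℕ) : ℝ) := by exact_mod_cast hgt
          refine (line_lt_iff_lt_cross hgt' _).2 ?_
          have := htplus_le T (Finset.mem_filter.2 ⟨hT, hgt⟩)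
          linarith
      · have h1 := hmax T hT
        rw [← hJ₁M, hTeq] at h1
        rw [hTeq]
        linarith
    refine ⟨(sstar + tplus) / 2, by linarith, hE1, fun T hT => ?_, fun T hT hTne => (hkey T hT).1 hTne⟩
    rcases eq_or_ne (∑ l ∈ T, d l) (∑ l ∈ J₁, d l) with h | h
    · exact (hkey T hT).2 h
    · exact ((hkey T hT).1 h).le

/-- **THE RANK POTENTIAL STRICTLY INCREASES ALONG THE CHAIN OF DOMINANT CLASSES** (repeated slopes allowed): `S` on top at `s`, `S'` on
top at `s' > s`, different classes ⇒ `Φ(S) < Φ(S')`. [induction through `exists_next_dominantClass`] -/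
theorem rankPotential_lt_of_dominantClass (𝒮 : Finset (Finset (Fin K))) (a : Finset (Fin K) → ℝ) (d : Fin K → ℕ)
    (m : ℕ) (hcard : ∀ S ∈ 𝒮, S.card = m)
    (hX : ∀ A ∈ 𝒮, ∀ B ∈ 𝒮, ∀ i ∈ A \ B, ∃ j ∈ B \ A, insert j (A.erase i) ∈ 𝒮 ∧ insert i (B.erase j) ∈ 𝒮 ∧
      a A + a B ≤ a (insert j (A.erase i)) + a (insert i (B.erase j))) :
    ∀ (n : ℕ) (S S' : Finset (Fin K)) (s s' : ℝ), (𝒮.filter fun T => ∑ l ∈ S, d l < ∑ l ∈ T, d l).card ≤ n →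
      S ∈ 𝒮 → (∀ T ∈ 𝒮, a T + s * ((∑ l ∈ T, d l : ℕ) : ℝ) ≤ a S + s * ((∑ l ∈ S, d l : ℕ) : ℝ)) →
      (∀ T ∈ 𝒮, ∑ l ∈ T, d l ≠ ∑ l ∈ S, d l → a T + s * ((∑ l ∈ T, d l : ℕ) : ℝ) < a S + s * ((∑ l ∈ S, d l : ℕ) : ℝ)) →
      S' ∈ 𝒮 → (∀ T ∈ 𝒮, a T + s' * ((∑ l ∈ T, d l : ℕ) : ℝ) ≤ a S' + s' * ((∑ l ∈ S', d l : ℕ) : ℝ)) →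
      (∀ T ∈ 𝒮, ∑ l ∈ T, d l ≠ ∑ l ∈ S', d l →
        a T + s' * ((∑ l ∈ T, d l : ℕ) : ℝ) < a S' + s' * ((∑ l ∈ S', d l : ℕ) : ℝ)) →
      s < s' → ∑ l ∈ S, d l ≠ ∑ l ∈ S', d l →
      ∑ l ∈ S, (univ.filter fun x => d x < d l).card < ∑ l ∈ S', (univ.filter fun x => d x < d l).card := by
  intro n
  induction n with
  | zero =>
    intro S S' s s' hn hS hSle hSlt hS' hS'le hS'lt hss hne
    obtain ⟨J₁, hJ₁, hEJ₁, -, -⟩ := exists_next_dominantClass 𝒮 a d m hcard hX hS hSle hSlt hS' hS'le hS'lt hss hne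
    have : J₁ ∈ 𝒮.filter fun T => ∑ l ∈ S, d l < ∑ l ∈ T, d l := Finset.mem_filter.2 ⟨hJ₁, hEJ₁⟩
    exact absurd hn (not_le.2 (Finset.card_pos.2 ⟨J₁, this⟩))
  | succ n ih =>
    intro S S' s s' hn hS hSle hSlt hS' hS'le hS'lt hss hne
    obtain ⟨J₁, hJ₁, hEJ₁, hΦ, hor⟩ := exists_next_dominantClass 𝒮 a d m hcard hX hS hSle hSlt hS' hS'le hS'lt hss hne
    rcases hor with ⟨-, hΦeq⟩ | ⟨t₁, ht₁, hneJ, hJ₁le, hJ₁lt⟩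
    · rw [hΦeq] at hΦ; exact hΦ
    · have hμ : (𝒮.filter fun T => ∑ l ∈ J₁, d l < ∑ l ∈ T, d l).card ≤ n := by
        have hss' : (𝒮.filter fun T => ∑ l ∈ J₁, d l < ∑ l ∈ T, d l) ⊂
            (𝒮.filter fun T => ∑ l ∈ S, d l < ∑ l ∈ T, d l) := by
          rw [Finset.ssubset_iff_subset_ne]
          refine ⟨fun T hT => ?_, fun heq => ?_⟩
          · obtain ⟨hT𝒮, hTE⟩ := Finset.mem_filter.1 hT
            exact Finset.mem_filter.2 ⟨hT𝒮, hEJ₁.trans hTE⟩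
          · have : J₁ ∈ 𝒮.filter fun T => ∑ l ∈ J₁, d l < ∑ l ∈ T, d l :=
              heq.symm ▸ Finset.mem_filter.2 ⟨hJ₁, hEJ₁⟩
            exact lt_irrefl _ (Finset.mem_filter.1 this).2
        exact Nat.lt_succ_iff.1 ((Finset.card_lt_card hss').trans_le hn)
      exact hΦ.trans (ih J₁ S' t₁ s' hμ hJ₁ hJ₁le hJ₁lt hS' hS'le hS'lt ht₁ hneJ)

/-! ## §4 The count of dominant classes -/

/-- **AT MOST `m (K − 1) + 1` DOMINANT CLASSES** (repeated slopes allowed): a finite set of exponents each of which is on top at some slope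
(through some set of its class, weakly over the class and strictly over the other classes) has at most `m · (K − 1) + 1` members — the
rank potential of the witnesses is injective on it and bounded by `m (K − 1)`. [elementary] -/
theorem card_dominantClasses_le (𝒮 : Finset (Finset (Fin K))) (a : Finset (Fin K) → ℝ) (d : Fin K → ℕ)
    (m : ℕ) (hcard : ∀ S ∈ 𝒮, S.card = m)
    (hX : ∀ A ∈ 𝒮, ∀ B ∈ 𝒮, ∀ i ∈ A \ B, ∃ j ∈ B \ A, insert j (A.erase i) ∈ 𝒮 ∧ insert i (B.erase j) ∈ 𝒮 ∧
      a A + a B ≤ a (insert j (A.erase i)) + a (insert i (B.erase j)))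
    (𝒟 : Finset ℕ)
    (h𝒟 : ∀ E ∈ 𝒟, ∃ S ∈ 𝒮, ∑ l ∈ S, d l = E ∧ ∃ t : ℝ,
      (∀ T ∈ 𝒮, a T + t * ((∑ l ∈ T, d l : ℕ) : ℝ) ≤ a S + t * ((∑ l ∈ S, d l : ℕ) : ℝ)) ∧
      (∀ T ∈ 𝒮, ∑ l ∈ T, d l ≠ ∑ l ∈ S, d l → a T + t * ((∑ l ∈ T, d l : ℕ) : ℝ) < a S + t * ((∑ l ∈ S, d l : ℕ) : ℝ))) :
    𝒟.card ≤ m * (K - 1) + 1 := by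
  choose sel hsel_mem hsel_sum hsel_dom using h𝒟
  set Ψ : ℕ → ℕ := fun E => if h : E ∈ 𝒟 then ∑ l ∈ sel E h, (univ.filter fun x => d x < d l).card else 0 with hΨ
  have hΨ_of : ∀ E (h : E ∈ 𝒟), Ψ E = ∑ l ∈ sel E h, (univ.filter fun x => d x < d l).card := by
    intro E h
    rw [hΨ]
    simp only [dif_pos h]
  -- Ψ is injective on 𝒟
  have hinj : Set.InjOn Ψ (𝒟 : Set ℕ) := by
    intro E hE E' hE' hΨeq
    have hED : E ∈ 𝒟 := Finset.mem_coe.1 hE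
    have hE'D : E' ∈ 𝒟 := Finset.mem_coe.1 hE'
    by_contra hne
    obtain ⟨t, hle, hlt⟩ := hsel_dom E hED
    obtain ⟨t', hle', hlt'⟩ := hsel_dom E' hE'D
    have hneS : ∑ l ∈ sel E hED, d l ≠ ∑ l ∈ sel E' hE'D, d l := by
      rw [hsel_sum E hED, hsel_sum E' hE'D]; exact hne
    rw [hΨ_of E hED, hΨ_of E' hE'D] at hΨeq
    rcases lt_trichotomy t t' with h1 | h2 | h3
    · exact absurd hΨeq (ne_of_lt (rankPotential_lt_of_dominantClass 𝒮 a d m hcard hX _ _ _ t t' le_rfl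
        (hsel_mem E hED) hle hlt (hsel_mem E' hE'D) hle' hlt' h1 hneS))
    · subst h2
      exact lt_asymm (hlt _ (hsel_mem E' hE'D) hneS.symm) (hlt' _ (hsel_mem E hED) hneS)
    · exact absurd hΨeq.symm (ne_of_lt (rankPotential_lt_of_dominantClass 𝒮 a d m hcard hX _ _ _ t' t le_rfl
        (hsel_mem E' hE'D) hle' hlt' (hsel_mem E hED) hle hlt h3 hneS.symm))
  -- Ψ maps 𝒟 into `range (m (K - 1) + 1)`
  have hrange : ∀ E ∈ 𝒟, Ψ E ∈ Finset.range (m * (K - 1) + 1) := by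
    intro E hE
    rw [Finset.mem_range, Nat.lt_succ_iff, hΨ_of E hE]
    calc ∑ l ∈ sel E hE, (univ.filter fun x => d x < d l).card ≤ ∑ _l ∈ sel E hE, (K - 1) :=
          Finset.sum_le_sum fun l _ => rank_le d l
      _ = m * (K - 1) := by rw [Finset.sum_const, smul_eq_mul, hcard _ (hsel_mem E hE)]
  calc 𝒟.card ≤ (Finset.range (m * (K - 1) + 1)).card := Finset.card_le_card_of_injOn Ψ hrange hinj
    _ = m * (K - 1) + 1 := Finset.card_range _

end Summit.ValiantsHypothesis.ValiantsHypothesis.Theorems.KPlusLogSqLaw.ValDoor
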